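import Summits.BirchSwinnertonDyer.BirchSwinnertonDyer.Theorems.PrintCf2RubinValueTwoKatzMeasureJZeroSeamModelLattice
import Summits.BirchSwinnertonDyer.BirchSwinnertonDyer.Theorems.PrintCf2RubinValueTwoKatzMeasureJZeroPsiPin
import Literature.NumberTheory.ComplexMultiplication.EllipticUnits.GrossencharacterReciprocity
import HarnessLib

/-!
# The model lattice of `49a1` WITH ITS GRÖSSENCHARACTER, once and level-free ([I2] FILE-4, piece (b))

Cell `bsd-print-cf2`, LEAD seat `bsd-line-cf2-p1` g20, crux `stmt-BirchSwinnertonDyer-20368` (`PrintCf2.SplitBadTwoRankOneOfFacts`),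
registered skeleton v14.10, BRIDGE stub `stub_perLevelBridge_two` (= `P1`); this file serves the [I2] input `perUnitValues_of_lane`
(FILE-4, LEAD) of the bridge `P1_of_lane` (-w3 g32): it packages, ONCE AND BEFORE the tame set `S` is chosen, the data that the
per-level socket `KatzMeasureJZeroSeam.forall_label_moment_eq_at_level` (FILE-3b, -w8 g14) takes as hypotheses about the curve:

* the MODEL LATTICE `Λ_L = Ω_E·w₀(𝓞_K)` of `W = [1,−1,0,−2,−1]` (`exists_modelLattice_cm7`, p771777) — `hLE hΩE h₂ h₃`;
* its GRÖSSENCHARACTER `(𝔣ψ, ψ_K)` from the fifth print (de Shalit II.1.5, `DeShalit1987.prop15_grossencharacterReciprocity`, taken as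
  the hypothesis `h15` and applied ONCE to `L` with the `K`-rational invariants `(35/4, 49/8)`): clauses (ii) `hψmul`, (iii) `hψspan`,
  (iv) `hψone`, (vi) `h6`, (vii) `h7` VERBATIM in FILE-3b's binder shapes, `𝔣ψ ≠ 0`, `v ∤ 𝔣ψ` (clause (v) at the good model
  `[1,−1,0,−2,−1]`, `isCoprime_of_clause_v_cm7`) and the PSI-PIN `ψ_K(v) = α₀` (`psi_apply_eq_generator`, p767? PsiPin).

Main result ★★ `exists_modelLattice_grossencharacter`.  THEOREMS ONLY; CONDITIONAL on the print `h15` (hypothesis); nothing is closed;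
no summit statement is proved by this seat; BSD is not proved by any of this.

References: [deShalit1987] E. de Shalit, *Iwasawa theory of elliptic curves with complex multiplication* (1987), II §1.5 (15) (18) (21),
II §1.8 (i), II §1.10 Lemma, II §4.2 (6); [CoatesWiles1977] J. Coates, A. Wiles, *On the conjecture of Birch and Swinnerton-Dyer*,
Invent. Math. 39 (1977), §1.
-/

-- the summit namespace `Summit.BirchSwinnertonDyer.BirchSwinnertonDyer` repeats the problem name by design (D-0017)
set_option linter.dupNamespace false
set_option autoImplicit false

noncomputable section

open scoped Classical
open scoped NumberField nonZeroDivisors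
open IsDedekindDomain NumberField Field PeriodPair
open Literature.NumberTheory.NumberFields Literature.NumberTheory.EllipticCurves
  Literature.NumberTheory.ComplexMultiplication.EllipticUnits
open Literature.NumberTheory.GaloisRepresentations
open Literature.NumberTheory.LFunctions.AbelianDensity (artinSymbol)

namespace Summit.BirchSwinnertonDyer.BirchSwinnertonDyer.Theorems.PrintCf2.KatzMeasureJZeroSeam

variable {K : Type} [Field K] [NumberField K]

/-- `c₄(W ⊗ ℂ)/12 = 35/4` for `W = [1,−1,0,−2,−1]` (`c₄ = 105`). [cite: deShalit1987, II §4.2 (6)] -/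
theorem cm7_baseChange_c₄_div :
    (((⟨1, -1, 0, -2, -1⟩ : WeierstrassCurve ℤ)).baseChange ℂ).c₄ / 12 = (35 / 4 : ℂ) := by
  simp only [WeierstrassCurve.baseChange, WeierstrassCurve.map_c₄, GoldfeldGoodTwists.int49a1_c₄]
  norm_num

/-- `c₆(W ⊗ ℂ)/216 = 49/8` for `W = [1,−1,0,−2,−1]` (`c₆ = 1323`). [cite: deShalit1987, II §4.2 (6)] -/
theorem cm7_baseChange_c₆_div :
    (((⟨1, -1, 0, -2, -1⟩ : WeierstrassCurve ℤ)).baseChange ℂ).c₆ / 216 = (49 / 8 : ℂ) := by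
  simp only [WeierstrassCurve.baseChange, WeierstrassCurve.map_c₆, cm7Int_c₆]
  norm_num

omit [NumberField K] in
/-- `7 ∉ v` for `v ∣ 2` (`1 = 7 − 3·2`). [cite: deShalit1987, II §1.10 Lemma] -/
theorem seven_notMem_of_two_mem {v : HeightOneSpectrum (𝓞 K)} (hv : ((2 : ℕ) : 𝓞 K) ∈ v.asIdeal) : (7 : 𝓞 K) ∉ v.asIdeal := by
  intro h7
  have h2 : (2 : 𝓞 K) ∈ v.asIdeal := by exact_mod_cast hv
  have h1 : (1 : 𝓞 K) ∈ v.asIdeal := by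
    have : (1 : 𝓞 K) = 7 - 3 * 2 := by norm_num
    rw [this]; exact v.asIdeal.sub_mem h7 (v.asIdeal.mul_mem_left _ h2)
  exact v.isPrime.ne_top ((Ideal.eq_top_iff_one _).mpr h1)

omit [NumberField K] in
/-- A proper coprime ideal is not below a prime: `IsCoprime v 𝔣 → ¬ 𝔣 ≤ v`. [cite: deShalit1987, II §1.8 (i)] -/
theorem not_le_of_isCoprime {v : HeightOneSpectrum (𝓞 K)} {𝔣 : Ideal (𝓞 K)} (h : IsCoprime v.asIdeal 𝔣) : ¬ 𝔣 ≤ v.asIdeal := by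
  intro hle
  have htop : v.asIdeal ⊔ 𝔣 = ⊤ := Ideal.isCoprime_iff_sup_eq.mp h
  rw [sup_eq_left.mpr hle] at htop
  exact v.isPrime.ne_top htop

set_option maxHeartbeats 800000 in
/-- ★★ **THE MODEL LATTICE WITH ITS GRÖSSENCHARACTER, level-free.**  For `K` imaginary quadratic with `d_K = −7`, `w₀ : K → ℂ`,
`v ∣ 2` with trace-one generator `α₀` (`v = (α₀)`, `α₀² − α₀ + 2 = 0`), GIVEN the fifth print `h15` (de Shalit II.1.5): there are a
period pair `L` and `Ω_E ≠ 0` with `Λ_L = Ω_E·w₀(𝓞_K)`, `g₂(L) = c₄(W ⊗ ℂ)/12`, `g₃(L) = c₆(W ⊗ ℂ)/216` (`W = [1,−1,0,−2,−1]`), and a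
Grössencharacter datum `(𝔣ψ, ψ_K)` with `𝔣ψ ≠ 0`, `v ∤ 𝔣ψ`, clauses (ii) (iii) (iv), the PSI-PIN `ψ_K(v) = α₀`, and the reciprocity
clauses (vi) (vii) on `𝔠`-division points at the level `K(𝔣ψ𝔠)` — exactly the binders `L ΩE hLE hΩE h₂ h₃ ψK 𝔣ψ h𝔣ψ0 hv𝔣ψ hψmul
hψspan hψv h6 h7` of `forall_label_moment_eq_at_level` and the conjuncts `𝔣ψ ≠ ⊥ ∧ hψmul ∧ hψspan ∧ hψone ∧ ψK v = α₀` exported by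
`perUnitValues_of_lane`. [cite: deShalit1987, II §1.5 (15) (18) (21), II §1.8 (i), II §1.10 Lemma, II §4.2 (6)]
[cite: CoatesWiles1977, §1 (p. 225)] -/
theorem exists_modelLattice_grossencharacter
    (h15 : DeShalit1987.prop15_grossencharacterReciprocity)
    (hK : IsImaginaryQuadratic K) (hdK : NumberField.discr K = -7) (w₀ : InfinitePlace K)
    {v : HeightOneSpectrum (𝓞 K)} (hv2 : ((2 : ℕ) : 𝓞 K) ∈ v.asIdeal)
    {α₀ : 𝓞 K} (hv0 : v.asIdeal = Ideal.span {α₀}) (hα₀ : α₀ ^ 2 - α₀ + 2 = 0) :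
    ∃ (L : PeriodPair) (ΩE : ℂ) (𝔣ψ : Ideal (𝓞 K)) (ψK : Ideal (𝓞 K) → 𝓞 K),
      (∀ z : ℂ, z ∈ L.lattice ↔ ∃ a : 𝓞 K, z = ΩE * w₀.embedding (a : K)) ∧ ΩE ≠ 0 ∧
      L.g₂ = (((⟨1, -1, 0, -2, -1⟩ : WeierstrassCurve ℤ)).baseChange ℂ).c₄ / 12 ∧
      L.g₃ = (((⟨1, -1, 0, -2, -1⟩ : WeierstrassCurve ℤ)).baseChange ℂ).c₆ / 216 ∧
      𝔣ψ ≠ ⊥ ∧ ¬ 𝔣ψ ≤ v.asIdeal ∧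
      (∀ 𝔞 𝔟 : Ideal (𝓞 K), IsCoprime 𝔞 𝔣ψ → IsCoprime 𝔟 𝔣ψ → ψK (𝔞 * 𝔟) = ψK 𝔞 * ψK 𝔟) ∧
      (∀ 𝔞 : Ideal (𝓞 K), IsCoprime 𝔞 𝔣ψ → Ideal.span {ψK 𝔞} = 𝔞) ∧
      (∀ α : 𝓞 K, α - 1 ∈ 𝔣ψ → ψK (Ideal.span {α}) = α) ∧
      ψK v.asIdeal = α₀ ∧
      (∀ 𝔠 : Ideal (𝓞 K), 𝔠 ≠ ⊥ → ∀ z : ℂ, z ∈ idealInvLattice w₀.embedding 𝔠 L.lattice → z ∉ L.lattice →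
        ∃ x y : rayClassField K (𝔣ψ * 𝔠), algClosureEmb w₀.embedding x = ℘[L] z ∧ algClosureEmb w₀.embedding y = ℘'[L] z) ∧
      (∀ 𝔠 : Ideal (𝓞 K), 𝔠 ≠ ⊥ → ∀ z : ℂ, z ∈ idealInvLattice w₀.embedding 𝔠 L.lattice → z ∉ L.lattice →
        ∀ 𝔟 : Ideal (𝓞 K), IsCoprime 𝔟 (𝔣ψ * 𝔠) → ∀ x y : rayClassField K (𝔣ψ * 𝔠),
          algClosureEmb w₀.embedding x = ℘[L] z → algClosureEmb w₀.embedding y = ℘'[L] z →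
            algClosureEmb w₀.embedding (artinSymbol (galFrob K (rayClassField K (𝔣ψ * 𝔠))) 𝔟 x) =
                ℘[L] (w₀.embedding (ψK 𝔟 : K) * z) ∧
            algClosureEmb w₀.embedding (artinSymbol (galFrob K (rayClassField K (𝔣ψ * 𝔠))) 𝔟 y) =
                ℘'[L] (w₀.embedding (ψK 𝔟 : K) * z)) := by
  -- the model lattice (Coates–Wiles period leaf at `j = −3375`)
  obtain ⟨ΩE, L, hΩE, hLE, hCM, h₂, h₃⟩ := exists_modelLattice_cm7 hK hdK w₀.embedding
  -- the `K`-rational invariants `(g₂₀, g₃₀) = (μ⁻⁴·35/4, μ⁻⁶·49/8)` at `μ = 1`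
  have hg₂ : L.g₂ = w₀.embedding ((((1 : Kˣ) : K)⁻¹ ^ 4 * (35 / 4))) := by
    rw [h₂, cm7_baseChange_c₄_div]
    simp only [Units.val_one, inv_one, one_pow, one_mul, map_div₀, map_ofNat]
  have hg₃ : L.g₃ = w₀.embedding ((((1 : Kˣ) : K)⁻¹ ^ 6 * (49 / 8))) := by
    rw [h₃, cm7_baseChange_c₆_div]
    simp only [Units.val_one, inv_one, one_pow, one_mul, map_div₀, map_ofNat]
  -- the fifth print, applied ONCE
  obtain ⟨𝔣, ψ, ⟨h𝔣0, -⟩, hmul, hspan, hone, hv5, h67⟩ := h15 K hK w₀.embedding L _ _ hCM hg₂ hg₃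
  -- clause (v) at the good model `[1,−1,0,−2,−1]` ⇒ `𝔣` is supported above `7`
  have h𝔣7 : ∀ w : HeightOneSpectrum (𝓞 K), (7 : 𝓞 K) ∉ w.asIdeal → IsCoprime w.asIdeal 𝔣 :=
    KatzMeasureJZeroTop.isCoprime_of_clause_v_cm7 1 hv5
  have hvcop : IsCoprime v.asIdeal 𝔣 := h𝔣7 v (seven_notMem_of_two_mem hv2)
  refine ⟨L, ΩE, 𝔣, ψ, hLE, hΩE, h₂, h₃, h𝔣0, not_le_of_isCoprime hvcop, hmul, hspan, hone,
    KatzMeasureJZeroTop.psi_apply_eq_generator hK hdK h𝔣0 hmul hspan hone h𝔣7 hv2 hv0 hα₀, ?_, ?_⟩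
  · intro 𝔠 h𝔠 z hz hzL
    exact (h67 𝔠 h𝔠 z hz hzL).1
  · intro 𝔠 h𝔠 z hz hzL 𝔟 h𝔟 x y hx hy
    exact (h67 𝔠 h𝔠 z hz hzL).2 𝔟 h𝔟 x y hx hy

end Summit.BirchSwinnertonDyer.BirchSwinnertonDyer.Theorems.PrintCf2.KatzMeasureJZeroSeam

end
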